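import Summits.RiemannHypothesis.RiemannHypothesis.Theorems.IntegerScrewScrewPolyFloorLandauHelson
import HarnessLib

/-!
# Route IntegerScrew — RH-free lower bound for the Landau pairing over a window of zeros

Helper file for crux `IntegerScrew.ScrewPolyFloor` (stmt-RiemannHypothesis-15757), idea card
`Cruxes/ScrewPolyFloor/Ideas/abscissa-blind-head.md` (TailFloor) and the stubs `stub_gonekLandau`,
`stub_blockMeanValue`, `stub_blockZeroCount` of `Lines/landau_gonek_floor.lean`, WITHOUT RH. For a
real vector `y` on `[1, M]` write `P_y(s) = ∑_{m ≤ M} y_m m^s` and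

  `D(T) = ∑_{|Im ρ| ≤ T} m(ρ) P_y(ρ − ½) P_y(½ − ρ)`   (the sum over `weilZeroIndex T`),

the truncation at height `T` of the pairing in which the screw form is expanded unconditionally
(`hasSum_screwForm`). Then (`pairing_window_lower_bound`) there is an absolute `C` with, for
`M ≥ 1`, `2 ≤ T₁ ≤ T₂`,

  `Re(D(T₂) − D(T₁)) ≥ (N_±(T₂) − N_±(T₁)) ‖y‖² − ((T₂ − T₁)/π)(log M + 1) ‖y‖² − C M⁵ (log T₂)² ‖y‖²`,

`N_±(T) = ∑_{|Im ρ| ≤ T} m(ρ) = 2N(T)`. Under RH each term of `D` is `m(ρ)|P_y(iγ)|² ≥ 0`; here no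
hypothesis on the zeros is made: the bilinear structure is evaluated by LANDAU'S FORMULA
(`Literature.NumberTheory.LFunctions.LandauGonek.landau_gonek_formula`,
`L(x;T) = ∑ m(ρ)x^ρ = −(T/π)Λ(x) + O(x²((1 + 1/log x)² log²T + min(T, x/⟨x⟩)))`, and for `x = m/m'`:
`1/log x ≤ M`, `x/⟨x⟩ ≤ M²`), the diagonal is the zero count, and the von Mangoldt main terms
assemble into the route's Helson form, bounded by `combHelsonBound_proof`
(`2 ∑_{m' | m} Λ(m/m')(m'/m)^{1/2} y_m y_m' ≤ (log M + 1)‖y‖²`). With the Riemann–von Mangoldt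
formula this is positive with a margin `≍ (T₂ − T₁) log T₁ ‖y‖²` as soon as `log T₁ ≫ log M` and
`T₂ − T₁ ≫ M⁵ log T₂` — the RH-free reservoir of the high zeros.
-/

noncomputable section

open Complex Finset
open scoped Real ComplexConjugate

-- the layout-mandated namespace repeats the summit name
set_option linter.dupNamespace false

namespace Summit.RiemannHypothesis.RiemannHypothesis.Theorems.IntegerScrewLandau

open Literature.NumberTheory.LFunctions ArithmeticFunction

/-! ### The window lower bound -/

/-- **RH-free lower bound for the Landau pairing over a window of zeros.** There is an absolute
`C > 0` such that for all `M ≥ 1`, all real `y`, and all `2 ≤ T₁ ≤ T₂`,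
`Re(D(T₂) − D(T₁)) ≥ (N_±(T₂) − N_±(T₁))·∑y² − ((T₂−T₁)/π)(log M + 1)·∑y² − C·M⁵·(log T₂)²·∑y²`,
where `D(T) = ∑_{|Im ρ| ≤ T} m(ρ) P_y(ρ−½)P_y(−(ρ−½))`, `P_y(s) = ∑_{m ≤ M} y_m m^s`, and
`N_±(T) = ∑_{|Im ρ| ≤ T} m(ρ)`. The pairing is written as `∑_{m,m'} y_m y_m' (√m'/√m) L(m/m';T)`
(`pairingSum_eq`), symmetrised in `(m, m')` with the reflection `L(x⁻¹) = x⁻¹ L(x)`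
(`landauSum_reflect`): the diagonal is `N_± ∑y²`, each pair `m > m'` contributes
`2 y_m y_m' (√m'/√m)(L(m/m';T₂) − L(m/m';T₁))`, which Landau's formula
(`landau_gonek_formula`, `landauSum_ratio_bound`) evaluates as
`−((T₂−T₁)/π)·2y_m y_m'(√m'/√m)Λ(m/m') + O(M⁴ log²T₂ |y_m y_m'|)`; the main terms are the Helson form
(`two_mul_mainTerms_le`, i.e. `combHelsonBound_proof`) and `(∑|y_m|)² ≤ M ∑ y_m²`. [folklore] -/
theorem pairing_window_lower_bound :
    ∃ C : ℝ, 0 < C ∧ ∀ (M : ℕ), 1 ≤ M → ∀ (y : ℕ → ℝ) (T₁ T₂ : ℝ), 2 ≤ T₁ → T₁ ≤ T₂ →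
      ((∑ ρ ∈ (weilZeroIndex_finite T₂).toFinset, (riemannZetaZeroOrder ρ : ℝ)) -
          ∑ ρ ∈ (weilZeroIndex_finite T₁).toFinset, (riemannZetaZeroOrder ρ : ℝ)) *
            ∑ m ∈ Icc 1 M, y m ^ 2 -
        (T₂ - T₁) / π * (Real.log M + 1) * ∑ m ∈ Icc 1 M, y m ^ 2 -
        C * (M : ℝ) ^ 5 * Real.log T₂ ^ 2 * ∑ m ∈ Icc 1 M, y m ^ 2 ≤
      ((∑ ρ ∈ (weilZeroIndex_finite T₂).toFinset, (riemannZetaZeroOrder ρ : ℂ) *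
          ((∑ m ∈ Icc 1 M, (y m : ℂ) * (m : ℂ) ^ (ρ - 1 / 2)) *
            (∑ m ∈ Icc 1 M, (y m : ℂ) * (m : ℂ) ^ (-(ρ - 1 / 2))))) -
        ∑ ρ ∈ (weilZeroIndex_finite T₁).toFinset, (riemannZetaZeroOrder ρ : ℂ) *
          ((∑ m ∈ Icc 1 M, (y m : ℂ) * (m : ℂ) ^ (ρ - 1 / 2)) *
            (∑ m ∈ Icc 1 M, (y m : ℂ) * (m : ℂ) ^ (-(ρ - 1 / 2))))).re := by
  obtain ⟨CL, hCL0, hCL⟩ := LandauGonek.landau_gonek_formula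
  refine ⟨16 * CL, by positivity, fun M hM y T₁ T₂ hT₁ h12 ↦ ?_⟩
  classical
  have hT₂ : 2 ≤ T₂ := hT₁.trans h12
  have hM0 : (0 : ℝ) < M := by exact_mod_cast hM
  -- notation
  set I : Finset ℕ := Icc 1 M with hI
  set S : ℝ := ∑ m ∈ I, y m ^ 2 with hS
  set Lf : ℝ → ℕ → ℕ → ℂ := fun T m m' ↦ ∑ ρ ∈ (weilZeroIndex_finite T).toFinset,
    (riemannZetaZeroOrder ρ : ℂ) * ((((m : ℝ) / m' : ℝ)) : ℂ) ^ ρ with hLf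
  set Nc : ℝ → ℂ := fun T ↦ ∑ ρ ∈ (weilZeroIndex_finite T).toFinset, (riemannZetaZeroOrder ρ : ℂ)
    with hNc
  set Nr : ℝ → ℝ := fun T ↦ ∑ ρ ∈ (weilZeroIndex_finite T).toFinset, (riemannZetaZeroOrder ρ : ℝ)
    with hNr
  have hNre : ∀ T, (Nc T).re = Nr T := by
    intro T; simp only [hNc, hNr, Complex.re_sum, Complex.intCast_re]
  set c : ℕ → ℕ → ℝ := fun m m' ↦ Real.sqrt m' / Real.sqrt m with hc
  set Λr : ℕ → ℕ → ℝ := fun m m' ↦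
    (if ((⌊(m : ℝ) / m'⌋₊ : ℕ) : ℝ) = (m : ℝ) / m' then Λ ⌊(m : ℝ) / m'⌋₊ else 0) with hΛr
  set F : ℕ → ℕ → ℝ := fun m m' ↦ y m * y m' * c m m' * Λr m m' with hF
  set G : ℝ → ℕ → ℕ → ℂ := fun T m m' ↦ (y m : ℂ) * (y m' : ℂ) * ((c m m' : ℝ) : ℂ) * Lf T m m'
    with hG
  set ΔT : ℝ := T₂ - T₁ with hΔT
  have hΔT0 : 0 ≤ ΔT := by rw [hΔT]; linarith
  set B : ℝ := 16 * CL * (M : ℝ) ^ 4 * Real.log T₂ ^ 2 with hB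
  have hB0 : 0 ≤ B := by positivity
  -- the pairing as a double sum
  have hD : ∀ T, ∑ ρ ∈ (weilZeroIndex_finite T).toFinset, (riemannZetaZeroOrder ρ : ℂ) *
      ((∑ m ∈ Icc 1 M, (y m : ℂ) * (m : ℂ) ^ (ρ - 1 / 2)) *
        (∑ m ∈ Icc 1 M, (y m : ℂ) * (m : ℂ) ^ (-(ρ - 1 / 2)))) = ∑ m ∈ I, ∑ m' ∈ I, G T m m' := by
    intro T; rw [pairingSum_eq]
  -- Landau at the ratios, both heights
  have hE : ∀ {m m' : ℕ}, 1 ≤ m' → m' < m → m ≤ M → ∀ {T : ℝ}, 2 ≤ T → T ≤ T₂ →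
      ‖Lf T m m' + (((T / π * Λr m m' : ℝ)) : ℂ)‖ ≤ 8 * CL * (M : ℝ) ^ 4 * Real.log T₂ ^ 2 := by
    intro m m' hm' hlt hmM T hT hTT₂
    refine (landauSum_ratio_bound hCL0 hCL hm' hlt hmM hT).trans ?_
    have hlog : Real.log T ≤ Real.log T₂ := Real.log_le_log (by linarith) hTT₂
    have hlog0 : 0 ≤ Real.log T := Real.log_nonneg (by linarith)
    gcongr
  -- the diagonal and the vanishing main terms
  have hcmm : ∀ {m : ℕ}, 1 ≤ m → c m m = 1 := fun {m} hm ↦ by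
    simp only [hc]; exact div_self (Real.sqrt_pos.2 (by exact_mod_cast hm)).ne'
  have hΛmm : ∀ {m : ℕ}, 1 ≤ m → Λr m m = 0 := fun {m} hm ↦ by
    simp only [hΛr]
    rw [div_self (by exact_mod_cast (Nat.one_le_iff_ne_zero.1 hm) : (m : ℝ) ≠ 0),
      show (1 : ℝ) = ((1 : ℕ) : ℝ) by norm_num, vonMangoldtReal_natCast]
    simp
  have hΛlt : ∀ {m m' : ℕ}, 1 ≤ m' → m' < m → Λr m' m = 0 := fun {m m'} hm' hlt ↦ by
    simp only [hΛr]
    have hm0 : (0 : ℝ) < m := by exact_mod_cast (lt_of_lt_of_le (Nat.lt_of_succ_le hm') hlt.le)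
    exact vonMangoldtReal_eq_zero_of_lt_one (by positivity) ((div_lt_one hm0).2 (by exact_mod_cast hlt))
  have hLf_mm : ∀ {m : ℕ}, 1 ≤ m → ∀ T, Lf T m m = Nc T := fun {m} hm T ↦ by
    simp only [hLf, hNc]
    rw [div_self (by exact_mod_cast (Nat.one_le_iff_ne_zero.1 hm) : (m : ℝ) ≠ 0)]
    exact landauSum_one T
  -- reflection: `G T m' m = G T m m'` for `m' < m`
  have hGsymm : ∀ {m m' : ℕ}, 1 ≤ m' → m' < m → ∀ T, G T m' m = G T m m' := by
    intro m m' hm' hlt T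
    have hm0 : (0 : ℝ) < m := by exact_mod_cast (lt_of_lt_of_le (Nat.lt_of_succ_le hm') hlt.le)
    have hm'0 : (0 : ℝ) < m' := by exact_mod_cast hm'
    have hx : (0 : ℝ) < (m' : ℝ) / m := by positivity
    simp only [hG, hLf, hc]
    rw [landauSum_reflect hx T, inv_div]
    have hsq : Real.sqrt m * Real.sqrt m = m := Real.mul_self_sqrt hm0.le
    have hsq' : Real.sqrt m' * Real.sqrt m' = m' := Real.mul_self_sqrt hm'0.le
    have hs0 : Real.sqrt m ≠ 0 := (Real.sqrt_pos.2 hm0).ne'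
    have hs0' : Real.sqrt m' ≠ 0 := (Real.sqrt_pos.2 hm'0).ne'
    have key : ((Real.sqrt m / Real.sqrt m' : ℝ) : ℂ) * ((((m' : ℝ) / m : ℝ)) : ℂ) =
        ((Real.sqrt m' / Real.sqrt m : ℝ) : ℂ) := by
      norm_cast
      field_simp
      nlinarith [hsq, hsq']
    calc (y m' : ℂ) * (y m : ℂ) * ((Real.sqrt m / Real.sqrt m' : ℝ) : ℂ) *
          (((((m' : ℝ) / m : ℝ)) : ℂ) * ∑ ρ ∈ (weilZeroIndex_finite T).toFinset,
            (riemannZetaZeroOrder ρ : ℂ) * ((((m : ℝ) / m' : ℝ)) : ℂ) ^ ρ)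
        = (y m : ℂ) * (y m' : ℂ) * (((Real.sqrt m / Real.sqrt m' : ℝ) : ℂ) * ((((m' : ℝ) / m : ℝ)) : ℂ)) *
            ∑ ρ ∈ (weilZeroIndex_finite T).toFinset,
              (riemannZetaZeroOrder ρ : ℂ) * ((((m : ℝ) / m' : ℝ)) : ℂ) ^ ρ := by ring
      _ = _ := by rw [key]
  -- termwise bound, ordered pairs `m' < m`
  have hpair : ∀ {m m' : ℕ}, 1 ≤ m' → m' < m → m ≤ M →
      -(ΔT / π * (2 * (F m m' + F m' m))) - 2 * |y m| * |y m'| * B ≤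
        ((G T₂ m m' - G T₁ m m') + (G T₂ m' m - G T₁ m' m)).re := by
    intro m m' hm' hlt hmM
    have hm0 : (0 : ℝ) < m := by exact_mod_cast (lt_of_lt_of_le (Nat.lt_of_succ_le hm') hlt.le)
    have hm'0 : (0 : ℝ) < m' := by exact_mod_cast hm'
    rw [hGsymm hm' hlt T₂, hGsymm hm' hlt T₁]
    -- `F m' m = 0`, `c m m' ≤ 1`
    have hF' : F m' m = 0 := by simp only [hF]; rw [hΛlt hm' hlt, mul_zero]
    have hc1 : c m m' ≤ 1 := by
      simp only [hc]
      rw [div_le_one (Real.sqrt_pos.2 hm0)]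
      exact Real.sqrt_le_sqrt (by exact_mod_cast hlt.le)
    have hc0 : 0 ≤ c m m' := by simp only [hc]; positivity
    -- Landau at both heights
    set e₂ : ℂ := Lf T₂ m m' + (((T₂ / π * Λr m m' : ℝ)) : ℂ) with he₂
    set e₁ : ℂ := Lf T₁ m m' + (((T₁ / π * Λr m m' : ℝ)) : ℂ) with he₁
    have hne₂ := hE hm' hlt hmM hT₂ le_rfl
    have hne₁ := hE hm' hlt hmM hT₁ h12
    rw [← he₂] at hne₂
    rw [← he₁] at hne₁
    have hdiff : (G T₂ m m' - G T₁ m m') + (G T₂ m m' - G T₁ m m') =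
        2 * ((y m : ℂ) * (y m' : ℂ) * ((c m m' : ℝ) : ℂ)) *
          (-(((ΔT / π * Λr m m' : ℝ)) : ℂ) + (e₂ - e₁)) := by
      simp only [hG, he₂, he₁, hΔT]
      push_cast
      ring
    rw [hdiff, hF', add_zero]
    -- real part
    have hre : (2 * ((y m : ℂ) * (y m' : ℂ) * ((c m m' : ℝ) : ℂ)) *
        (-(((ΔT / π * Λr m m' : ℝ)) : ℂ) + (e₂ - e₁))).re =
        -(ΔT / π * (2 * F m m')) + 2 * (y m * y m' * c m m') * (e₂ - e₁).re := by
      have e : (2 * ((y m : ℂ) * (y m' : ℂ) * ((c m m' : ℝ) : ℂ))) = (((2 * (y m * y m' * c m m') : ℝ)) : ℂ) := by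
        push_cast; ring
      rw [e, Complex.re_ofReal_mul, Complex.add_re, Complex.neg_re, Complex.ofReal_re]
      simp only [hF]
      ring
    rw [hre]
    have hEE : |(e₂ - e₁).re| ≤ B := by
      calc |(e₂ - e₁).re| ≤ ‖e₂ - e₁‖ := Complex.abs_re_le_norm _
        _ ≤ ‖e₂‖ + ‖e₁‖ := norm_sub_le _ _
        _ ≤ 8 * CL * (M : ℝ) ^ 4 * Real.log T₂ ^ 2 + 8 * CL * (M : ℝ) ^ 4 * Real.log T₂ ^ 2 :=
            add_le_add hne₂ hne₁
        _ = B := by rw [hB]; ring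
    have hprod : |2 * (y m * y m' * c m m') * (e₂ - e₁).re| ≤ 2 * |y m| * |y m'| * B := by
      rw [abs_mul, abs_mul, abs_mul, abs_mul, abs_of_pos (by norm_num : (0 : ℝ) < 2), abs_of_nonneg hc0]
      calc 2 * (|y m| * |y m'| * c m m') * |(e₂ - e₁).re| ≤ 2 * (|y m| * |y m'| * 1) * B := by
            gcongr
        _ = 2 * |y m| * |y m'| * B := by ring
    have := neg_abs_le (2 * (y m * y m' * c m m') * (e₂ - e₁).re)
    linarith
  -- termwise bound, all pairs
  have hterm : ∀ m ∈ I, ∀ m' ∈ I,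
      (if m = m' then 2 * y m ^ 2 * (Nr T₂ - Nr T₁) else 0) -
          ΔT / π * (2 * (F m m' + F m' m)) - 2 * |y m| * |y m'| * B ≤
        ((G T₂ m m' - G T₁ m m') + (G T₂ m' m - G T₁ m' m)).re := by
    intro m hm m' hm'
    rw [hI, Finset.mem_Icc] at hm hm'
    rcases lt_trichotomy m' m with hlt | heq | hgt
    · rw [if_neg (by omega : m ≠ m')]
      have := hpair hm'.1 hlt hm.2
      linarith
    · subst heq
      rw [if_pos rfl]
      have hFmm : F m' m' = 0 := by simp only [hF]; rw [hΛmm hm.1, mul_zero]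
      have hGmm : ∀ T, G T m' m' = (((y m' ^ 2 : ℝ)) : ℂ) * Nc T := fun T ↦ by
        simp only [hG]; rw [hLf_mm hm.1, hcmm hm.1]; push_cast; ring
      rw [hFmm, hGmm, hGmm]
      have hre : ((((y m' ^ 2 : ℝ)) : ℂ) * Nc T₂ - (((y m' ^ 2 : ℝ)) : ℂ) * Nc T₁ +
          ((((y m' ^ 2 : ℝ)) : ℂ) * Nc T₂ - (((y m' ^ 2 : ℝ)) : ℂ) * Nc T₁)).re =
          2 * y m' ^ 2 * (Nr T₂ - Nr T₁) := by
        simp only [Complex.add_re, Complex.sub_re, Complex.re_ofReal_mul, hNre]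
        ring
      rw [hre]
      have : 0 ≤ 2 * |y m'| * |y m'| * B := by positivity
      linarith
    · rw [if_neg (by omega : m ≠ m')]
      have := hpair hm.1 hgt hm'.2
      rw [add_comm (F m' m), add_comm (G T₂ m' m - G T₁ m' m)] at this
      have e : 2 * |y m'| * |y m| * B = 2 * |y m| * |y m'| * B := by ring
      linarith
  -- summation of the termwise bounds
  have hsum := Finset.sum_le_sum fun m hm ↦ Finset.sum_le_sum fun m' hm' ↦ hterm m hm m' hm'
  -- the left side, summed
  have hdiag : ∑ m ∈ I, ∑ m' ∈ I, (if m = m' then 2 * y m ^ 2 * (Nr T₂ - Nr T₁) else 0) =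
      2 * (Nr T₂ - Nr T₁) * S := by
    rw [hS, Finset.mul_sum]
    refine Finset.sum_congr rfl fun m hm ↦ ?_
    rw [Finset.sum_ite_eq I m (fun _ ↦ 2 * y m ^ 2 * (Nr T₂ - Nr T₁)), if_pos hm]
    ring
  have hFsum : ∑ m ∈ I, ∑ m' ∈ I, ΔT / π * (2 * (F m m' + F m' m)) =
      ΔT / π * (4 * ∑ m ∈ I, ∑ m' ∈ I, F m m') := by
    have h1 : ∑ m ∈ I, ∑ m' ∈ I, (F m m' + F m' m) = 2 * ∑ m ∈ I, ∑ m' ∈ I, F m m' := by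
      simp only [Finset.sum_add_distrib]
      rw [Finset.sum_comm (f := fun m m' ↦ F m' m)]
      ring
    simp only [← Finset.mul_sum]
    rw [h1]
    ring
  have hBsum : ∑ m ∈ I, ∑ m' ∈ I, 2 * |y m| * |y m'| * B = 2 * B * (∑ m ∈ I, |y m|) ^ 2 := by
    rw [sq, Finset.sum_mul_sum, Finset.mul_sum]
    refine Finset.sum_congr rfl fun m _ ↦ ?_
    rw [Finset.mul_sum]
    refine Finset.sum_congr rfl fun m' _ ↦ ?_
    ring
  have hLHS : ∑ m ∈ I, ∑ m' ∈ I,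
      ((if m = m' then 2 * y m ^ 2 * (Nr T₂ - Nr T₁) else 0) -
        ΔT / π * (2 * (F m m' + F m' m)) - 2 * |y m| * |y m'| * B) =
      2 * (Nr T₂ - Nr T₁) * S - ΔT / π * (4 * ∑ m ∈ I, ∑ m' ∈ I, F m m') -
        2 * B * (∑ m ∈ I, |y m|) ^ 2 := by
    simp only [Finset.sum_sub_distrib]
    rw [hdiag, hFsum, hBsum]
  -- the right side, summed: twice the real part of the difference
  have hRHS : ∑ m ∈ I, ∑ m' ∈ I, ((G T₂ m m' - G T₁ m m') + (G T₂ m' m - G T₁ m' m)).re =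
      2 * ((∑ m ∈ I, ∑ m' ∈ I, G T₂ m m') - ∑ m ∈ I, ∑ m' ∈ I, G T₁ m m').re := by
    have h := sum_sum_eq_half_symm I (fun m m' ↦ G T₂ m m' - G T₁ m m')
    have h2 : (∑ m ∈ I, ∑ m' ∈ I, G T₂ m m') - ∑ m ∈ I, ∑ m' ∈ I, G T₁ m m' =
        ∑ m ∈ I, ∑ m' ∈ I, (G T₂ m m' - G T₁ m m') := by
      simp only [Finset.sum_sub_distrib]
    rw [h2, h]
    simp only [Complex.re_sum, Complex.mul_re, Complex.re_sum]
    norm_num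
    ring
  -- Helson and Cauchy–Schwarz
  have hHelson : 2 * ∑ m ∈ I, ∑ m' ∈ I, F m m' ≤ (Real.log M + 1) * S := by
    have h := two_mul_mainTerms_le hM y
    simp only [hF, hc, hΛr, hI, hS] at h ⊢
    exact h
  have hCS : (∑ m ∈ I, |y m|) ^ 2 ≤ M * S := by rw [hI, hS]; exact sq_sum_abs_le M y
  -- conclusion
  rw [hD T₂, hD T₁]
  have key : 2 * ((Nr T₂ - Nr T₁) * S - ΔT / π * (Real.log M + 1) * S - B * M * S) ≤
      2 * ((∑ m ∈ I, ∑ m' ∈ I, G T₂ m m') - ∑ m ∈ I, ∑ m' ∈ I, G T₁ m m').re := by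
    rw [← hRHS]
    refine le_trans ?_ (hLHS ▸ hsum)
    have hπ : 0 ≤ ΔT / π := div_nonneg hΔT0 Real.pi_pos.le
    have h1 : ΔT / π * (4 * ∑ m ∈ I, ∑ m' ∈ I, F m m') ≤ ΔT / π * (2 * ((Real.log M + 1) * S)) := by
      refine mul_le_mul_of_nonneg_left ?_ hπ
      linarith
    have h2 : 2 * B * (∑ m ∈ I, |y m|) ^ 2 ≤ 2 * B * (M * S) :=
      mul_le_mul_of_nonneg_left hCS (by positivity)
    linarith
  have hBM : B * M * S = 16 * CL * (M : ℝ) ^ 5 * Real.log T₂ ^ 2 * S := by rw [hB]; ring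
  rw [hBM, hΔT] at key
  linarith

end Summit.RiemannHypothesis.RiemannHypothesis.Theorems.IntegerScrewLandau

end
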